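import Summits.AnomalousDissipation.AnomalousDissipation.Theorems.StirringSphereEnsembleRealizationStubAugLimitLawTools
import Summits.AnomalousDissipation.AnomalousDissipation.Theorems.StirringSphereEnsembleRealizationStubAugLimitEnergyTools
import Summits.AnomalousDissipation.AnomalousDissipation.Theorems.StirringSphereEnsembleRealizationStubAugLimitDriftTools
import Summits.AnomalousDissipation.AnomalousDissipation.Theorems.StirringSphereEnsembleRealizationStubAugLimitIdentTools
import Summits.AnomalousDissipation.AnomalousDissipation.Theorems.StirringSphereEnsembleRealizationStubAugLimitModesTools
import Summits.AnomalousDissipation.AnomalousDissipation.Theorems.MomentParityTimeAverages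
import Literature.Analysis.FluidPDE.StatisticalSolutionEnergyEq
import Literature.Analysis.FluidPDE.WeakSolution
import Literature.Analysis.FluidPDE.NSHopfGalerkin
import Literature.Analysis.FluidPDE.StokesTorusPositivityProofs

/-!
# Crux `EnsembleRealization` (stmt-AnomalousDissipation-0215) — line `augmented-lift`,
# sub-stub M2a `stub_augLimit` of stub `stub_augmentedLaw`: the limit law and its modewise
# identification (PROVED)

Supports stmt-AnomalousDissipation-0215 (registered sub-stub `stub_augLimit` of the reshaped stub
`stub_augmentedLaw`, line `augmented-lift`). Nothing here closes an item.

`stub_augLimit`: level laws `P n` on the compact augmented trajectory space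
`𝒦(R, pathLip ν ‖f‖₁ R) × [0, b]^ℚ` as produced by `stub_augCurrent` (probability, shift-invariant
path marginals, (MARG) joint one-time laws at rational times → law of `(û, ‖u‖²)`, (DRIFT) and
(ENERGY) links) have a limit: a shift-invariant probability law `Q` on `𝒦` with EXACT real-time
coefficient marginals `μ̂`, whose typical path carries a space–time measurable family of `L²`
fields with the coefficients of the path, the MODEWISE Navier–Stokes identities against every
Galerkin mode at all real times, locally finite enstrophy and the energy inequality between
rational times. Assembly of the five tools files: the limit law (`stub_augLimitLawTools`), the
energy inequality (`stub_augLimitEnergyTools`), the cylindrical approximants of the tested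
generator (`stub_augLimitDriftTools`), the Ambrosio–Trevisan identification at rational times
(`stub_augLimitIdentTools`), and the passage to all Galerkin modes and real times
(`stub_augLimitModesTools`); plus the vanishing of the zero coefficient under the marginals.
-/

noncomputable section

set_option linter.dupNamespace false

open MeasureTheory Set Filter Topology Function Metric UnitAddTorus
open scoped BigOperators ENNReal InnerProductSpace RealInnerProductSpace

namespace Summit.AnomalousDissipation.AnomalousDissipation.Theorems.EnsembleRealization

open Literature.Analysis.FunctionSpaces Literature.Analysis.FunctionSpaces.Torus
open Literature.Analysis.FluidPDE Literature.Analysis.FluidPDE.Torus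
open Summit.AnomalousDissipation.AnomalousDissipation.Theorems.MomentParity

variable {ν : ℝ} {f : UnitAddTorus (Fin 3) → EuclideanSpace ℝ (Fin 3)}
  {μ : Measure (Torus.energySpace (Fin 3))}

/-! ### The zero coefficient -/

/-- **The zero coefficient vanishes along almost every path** of a law on `𝒦(R, L)` whose
one-time coefficient marginals are the coefficient law of a measure on the (mean-free) energy
space `H`: at each time by the marginal identity, at all rational times at once, and at all real
times `t ≥ 0` by continuity of `t ↦ ω̄(t, 0)`. -/
theorem ae_pathExt_zero_eq_zero {R : ℝ} {L : (Fin 3 → ℤ) → ℝ} (Q : Measure ↥(pathSpace R L : Set (Path (Fin 3))))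
    (hmarg : ∀ t, 0 ≤ t → Q.map (fun ω => fun k : Fin 3 → ℤ => pathExt ω.1 t k) =
      μ.map (fun u : Torus.energySpace (Fin 3) => fun k : Fin 3 → ℤ =>
        mFourierCoeff (EuclideanSpace.complexify ∘ (u.1 : UnitAddTorus (Fin 3) → EuclideanSpace ℝ (Fin 3))) k)) :
    ∀ᵐ ω ∂Q, ∀ t : ℝ, 0 ≤ t → pathExt ω.1 t 0 = 0 := by
  have hS : MeasurableSet {c : (Fin 3 → ℤ) → EuclideanSpace ℂ (Fin 3) | c 0 = 0} :=
    measurableSet_eq_fun (measurable_pi_apply (0 : Fin 3 → ℤ)) measurable_const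
  have ht : ∀ t : ℝ, 0 ≤ t → ∀ᵐ ω ∂Q, pathExt ω.1 t 0 = 0 := by
    intro t ht
    have h : ∀ᵐ c ∂(μ.map (fun u : Torus.energySpace (Fin 3) => fun k : Fin 3 → ℤ =>
        mFourierCoeff (EuclideanSpace.complexify ∘ (u.1 : UnitAddTorus (Fin 3) → EuclideanSpace ℝ (Fin 3))) k)),
        c 0 = 0 :=
      (ae_map_iff measurable_fieldCoeff'.aemeasurable hS).2
        (ae_of_all _ fun u => mFourierCoeff_complexify_coe_zero_of_mem u.2)
    rw [← hmarg t ht] at h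
    exact (ae_map_iff (measurable_pathCoeff' R L t).aemeasurable hS).1 h
  have hq : ∀ᵐ ω ∂Q, ∀ q : ℚ, 0 ≤ q → pathExt ω.1 q 0 = 0 := by
    rw [ae_all_iff]; intro q
    by_cases hq : 0 ≤ q
    · filter_upwards [ht q (by exact_mod_cast hq)] with ω hω _ using hω
    · exact ae_of_all _ fun ω h => absurd h hq
  filter_upwards [hq] with ω hω t ht
  have h1 := tendsto_dyadic_apply ω.2 t 0
  have h2 : (fun n => ω.1 (dyadicFloor t n, 0)) = fun _ => 0 := funext fun n => by
    rw [← pathExt_ratCast ω.2 (dyadicFloor_nonneg t n), hω _ (dyadicFloor_nonneg t n)]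
  rw [h2] at h1
  exact tendsto_nhds_unique h1 tendsto_const_nhds

/-! ### The sub-stub -/

/-- **Sub-stub M2a (augmented limit; L/XL).** Level laws as produced by `stub_augCurrent` have a
limit: a shift-invariant probability law `Q` on `𝒦(R, pathLip ν ‖f‖₁ R)` with one-time coefficient
marginals EXACTLY `μ̂` at every real time, whose typical path carries a space–time measurable
family of `L²` fields `v t` with `𝓕(v t) = ω̄(t)`, locally finite enstrophy, the MODEWISE
Navier–Stokes identities `(v t, a) − (v s, a) = ∫ₛᵗ (⟪v, (v·∇)a⟫ + ν⟪v, Δa⟫ + ⟪f, a⟫)` against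
every Galerkin mode `a`, and the energy inequality between rational times
`E(v q') + ν ∫_q^{q'} ‖∇v‖² ≤ E(v q) + ∫_q^{q'} (f, v)`.
Proof sketch (notes §M2a): subsequential weak limit `Q̃` of `P n` on the compact metrizable
`𝒦 × [0, b]^ℚ` (`CompactSpace.tendsto_subseq` in `ProbabilityMeasure`, pattern of
`MomentParity.exists_shiftInvariant_limit`), `Q = Q̃.map Prod.fst`; shift invariance and the
rational-time joint marginals pass to the limit (continuity of evaluation), real-time marginals by
path continuity (`pathExt`, dominated convergence); Ambrosio–Trevisan identification
(arXiv:1402.4788, (7.4)–(7.6)): for a bounded continuous cylindrical `c`,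
`E_Q (|(v q', a) − (v q, a) − ∫ c| ∧ 1) ≤ liminf E_{P n}(…) ≤ (q' − q)‖⟨F, a⟩ − c∘𝓕‖_{L¹(μ)}`
and `E_Q |∫ (c∘𝓕 − ⟨F, a⟩)(v τ) dτ| ≤ (q' − q)‖c∘𝓕 − ⟨F, a⟩‖_{L¹(μ)}` by the marginal identity and
Fubini, then density of bounded continuous cylindrical functions in `L¹(μ̂)` (e.g.
`⟨F, a⟩ ∘ P_M → ⟨F, a⟩` in `L¹(μ)` by (1.29), truncated to a bounded function) — countably many
frame fields `a` (`Torus.exists_transversal_frame`) and rational times, then linearity and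
continuity in time; constant modes from `f` mean-zero and `ω̄(t, 0) = 0` a.s.; enstrophy
`E_Q ∫₀ᵀ ‖∇v‖² = T ∫ ‖u‖_V² dμ < ∞`; energy: the violation functional
`(x.2 q' − x.2 q + ∫ (2 pathDiss ν K − 2(f̂, x̄.1)))₊ ∧ 1` is bounded continuous, so its `Q̃`-mean
vanishes, `K → ∞` by monotone convergence (`pathDiss ≤ ν‖∇v‖²`, `eGradNormSq_eq_tsum`), Parseval
for `(f, v)` (`hasSum_re_inner_mFourierCoeff_complexify`), and the graph identity
`x.2 q = ∑' ‖x.1(q, ·)‖² = 2E(v q)` `Q̃`-a.s. (the joint marginal at `q` is carried by the graph of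
`c ↦ ∑' ‖c k‖²`, Parseval `enorm_sq_coe_eq_tsum` on `H`).
[arXiv:1402.4788 §7 Thm 7.1; FoiasRosaTemam2019 §3; FMRTTurbulence2001 IV (1.29)] -/
theorem stub_augLimit (hν : 0 < ν) (hf : IsSmooth f) (hf0 : HasZeroMean f)
    (hμ : IsStationaryStatisticalSolution ν f μ) {R : ℝ} (hR : ∀ᵐ u ∂μ, ‖u‖ ≤ R) {b : ℝ}
    (P : ℕ → Measure (↥(pathSpace R (pathLip ν (∫ x, ‖f x‖) R) : Set (Path (Fin 3))) ×
      ↥((Set.univ : Set ℚ).pi fun _ : ℚ => Set.Icc (0 : ℝ) b)))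
    (hP : ∀ n, IsProbabilityMeasure (P n))
    (hθ : ∀ n, ((P n).map Prod.fst).map (pathShiftOn R (pathLip ν (∫ x, ‖f x‖) R)
        (pathShift_mapsTo R (pathLip ν (∫ x, ‖f x‖) R))) = (P n).map Prod.fst)
    (hmargP : ∀ q : ℚ, 0 ≤ q → ∀ φ : ((Fin 3 → ℤ) → EuclideanSpace ℂ (Fin 3)) × ℝ → ℝ, Continuous φ →
      (∃ B : ℝ, ∀ z, |φ z| ≤ B) →
      Tendsto (fun n => ∫ x, φ ((fun k : Fin 3 → ℤ => x.1.1 (q, k)), x.2.1 q) ∂(P n)) atTop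
        (𝓝 (∫ u, φ ((fun k : Fin 3 → ℤ =>
          mFourierCoeff (EuclideanSpace.complexify ∘ (u.1 : UnitAddTorus (Fin 3) → EuclideanSpace ℝ (Fin 3))) k),
          ‖u‖ ^ 2) ∂μ)))
    (hdrift : ∀ a : UnitAddTorus (Fin 3) → EuclideanSpace ℝ (Fin 3), IsSmooth a → IsDivFree a → HasZeroMean a →
      ∀ c : ((Fin 3 → ℤ) → EuclideanSpace ℂ (Fin 3)) → ℝ, Continuous c → (∃ B : ℝ, ∀ z, |c z| ≤ B) →
      ∀ q q' : ℚ, 0 ≤ q → q ≤ q' → ∀ γ : ℝ, 0 < γ → ∀ᶠ n in atTop,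
        ∫ x, |(∑' k, (⟪mFourierCoeff (EuclideanSpace.complexify ∘ a) k, x.1.1 (q', k)⟫_ℂ).re) -
            (∑' k, (⟪mFourierCoeff (EuclideanSpace.complexify ∘ a) k, x.1.1 (q, k)⟫_ℂ).re) -
            ∫ τ in (q : ℝ)..q', c (fun k : Fin 3 → ℤ => pathExt x.1.1 τ k)| ∂(P n) ≤
          ((q' : ℝ) - q) * (∫ u, |nsGeneratorPairing ν f u a - c (fun k : Fin 3 → ℤ =>
            mFourierCoeff (EuclideanSpace.complexify ∘ (u.1 : UnitAddTorus (Fin 3) → EuclideanSpace ℝ (Fin 3))) k)| ∂μ) + γ)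
    (henergy : ∀ (K : ℕ) (q q' : ℚ), 0 ≤ q → q ≤ q' → ∀ γ : ℝ, 0 < γ → ∀ᶠ n in atTop,
      ∫ x, max 0 (x.2.1 q' - x.2.1 q + ∫ τ in (q : ℝ)..q',
          (2 * pathDiss ν K x.1.1 τ -
            2 * ∑' k, (⟪mFourierCoeff (EuclideanSpace.complexify ∘ f) k, pathExt x.1.1 τ k⟫_ℂ).re)) ∂(P n) ≤ γ) :
    ∃ Q : Measure ↥(pathSpace R (pathLip ν (∫ x, ‖f x‖) R) : Set (Path (Fin 3))),
      IsProbabilityMeasure Q ∧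
      Q.map (pathShiftOn R (pathLip ν (∫ x, ‖f x‖) R) (pathShift_mapsTo R (pathLip ν (∫ x, ‖f x‖) R))) = Q ∧
      (∀ t, 0 ≤ t → Q.map (fun ω => fun k : Fin 3 → ℤ => pathExt ω.1 t k) =
        μ.map (fun u : Torus.energySpace (Fin 3) => fun k : Fin 3 → ℤ =>
          mFourierCoeff (EuclideanSpace.complexify ∘ (u.1 : UnitAddTorus (Fin 3) → EuclideanSpace ℝ (Fin 3))) k)) ∧
      (∀ᵐ ω ∂Q, ∃ v : ℝ → UnitAddTorus (Fin 3) → EuclideanSpace ℝ (Fin 3),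
        AEStronglyMeasurable (stLift v) (volume.restrict (Ioi 0 ×ˢ univ)) ∧
        (∀ t, 0 ≤ t → MemLp (v t) 2 volume ∧
          ∀ k, mFourierCoeff (EuclideanSpace.complexify ∘ v t) k = pathExt ω.1 t k) ∧
        (∀ (M : ℕ) (a : UnitAddTorus (Fin 3) → EuclideanSpace ℝ (Fin 3)), IsGalerkinMode M a →
          ∀ s t : ℝ, 0 ≤ s → s ≤ t →
            (∫ x, ⟪v t x, a x⟫_ℝ) - ∫ x, ⟪v s x, a x⟫_ℝ =
              ∫ τ in s..t, ∫ x, (⟪v τ x, convect (v τ) a x⟫_ℝ + ν * ⟪v τ x, laplacian a x⟫_ℝ +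
                ⟪f x, a x⟫_ℝ)) ∧
        (∀ T, 0 < T → ∫⁻ t in Ioo 0 T, eGradNormSq (v t) < ∞) ∧
        (∀ q q' : ℚ, 0 ≤ q → q ≤ q' →
          kineticEnergy (v q') + ν * (∫⁻ τ in Ioo (q : ℝ) q', eGradNormSq (v τ)).toReal ≤
            kineticEnergy (v q) + ∫ τ in (q : ℝ)..q', ∫ x, ⟪f x, v τ x⟫_ℝ)) := by
  classical
  haveI := hμ.prob
  -- (i) the limit law
  obtain ⟨Qt, hQt, hle, hshift, hjoint, hmarg⟩ := stub_augLimitLawTools (μ := μ) P hP hθ hmargP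
  haveI := hQt
  haveI : IsProbabilityMeasure (Qt.map Prod.fst) := Measure.isProbabilityMeasure_map measurable_fst.aemeasurable
  refine ⟨Qt.map Prod.fst, inferInstance, hshift, hmarg, ?_⟩
  -- bounded continuous functionals of the path keep their eventual upper bounds
  have hleQ : ∀ g : ↥(pathSpace R (pathLip ν (∫ x, ‖f x‖) R) : Set (Path (Fin 3))) → ℝ, Continuous g →
      ∀ B : ℝ, (∀ ω, |g ω| ≤ B) → ∀ C : ℝ, (∀ γ : ℝ, 0 < γ → ∀ᶠ n in atTop, ∫ x, g x.1 ∂(P n) ≤ C + γ) →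
      ∫ ω, g ω ∂(Qt.map Prod.fst) ≤ C := by
    intro g hg B hB C hC
    rw [integral_map measurable_fst.aemeasurable hg.aestronglyMeasurable]
    exact hle (fun x => g x.1) (hg.comp continuous_fst) B (fun x => hB x.1) C hC
  -- (ii) the energy inequality and the enstrophy, almost surely
  have hE := stub_augLimitEnergyTools (μ := μ) hν hf Qt P hle hjoint henergy
  -- (iii) the zero coefficient
  have hZ := ae_pathExt_zero_eq_zero (μ := μ) (Qt.map Prod.fst) hmarg
  -- (iv) the modewise identities for the single real modes along transversal frames, at rational times
  choose fr hfrT hfr using fun k : Fin 3 → ℤ => Torus.exists_transversal_frame (d := Fin 3) k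
  have hsm : ∀ (k : Fin 3 → ℤ) (l : Fin 3 × Bool), IsSmooth (realTrigPoly {k} fun _ => fr k l) := fun k l =>
    isSmooth_realTrigPoly _ _
  have hI : ∀ᵐ ω ∂(Qt.map Prod.fst), ∀ k : Fin 3 → ℤ, k ≠ 0 → ∀ (l : Fin 3 × Bool) (q q' : ℚ), 0 ≤ q → q ≤ q' →
      ∀ v : ℝ → UnitAddTorus (Fin 3) → EuclideanSpace ℝ (Fin 3),
        (∀ t, 0 ≤ t → MemLp (v t) 2 volume ∧
          ∀ k', mFourierCoeff (EuclideanSpace.complexify ∘ v t) k' = pathExt ω.1 t k') →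
        (∫ x, ⟪v q' x, realTrigPoly {k} (fun _ => fr k l) x⟫_ℝ) -
            (∫ x, ⟪v q x, realTrigPoly {k} (fun _ => fr k l) x⟫_ℝ) =
          ∫ τ in (q : ℝ)..q', ∫ x, (⟪v τ x, convect (v τ) (realTrigPoly {k} fun _ => fr k l) x⟫_ℝ +
            ν * ⟪v τ x, laplacian (realTrigPoly {k} fun _ => fr k l) x⟫_ℝ +
            ⟪f x, realTrigPoly {k} (fun _ => fr k l) x⟫_ℝ) := by
    rw [ae_all_iff]; intro k
    by_cases hk : k = 0
    · exact ae_of_all _ fun ω h => absurd hk h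
    suffices h' : ∀ᵐ ω ∂(Qt.map Prod.fst), ∀ (l : Fin 3 × Bool) (q q' : ℚ), 0 ≤ q → q ≤ q' →
        ∀ v : ℝ → UnitAddTorus (Fin 3) → EuclideanSpace ℝ (Fin 3),
          (∀ t, 0 ≤ t → MemLp (v t) 2 volume ∧
            ∀ k', mFourierCoeff (EuclideanSpace.complexify ∘ v t) k' = pathExt ω.1 t k') →
          (∫ x, ⟪v q' x, realTrigPoly {k} (fun _ => fr k l) x⟫_ℝ) -
              (∫ x, ⟪v q x, realTrigPoly {k} (fun _ => fr k l) x⟫_ℝ) =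
            ∫ τ in (q : ℝ)..q', ∫ x, (⟪v τ x, convect (v τ) (realTrigPoly {k} fun _ => fr k l) x⟫_ℝ +
              ν * ⟪v τ x, laplacian (realTrigPoly {k} fun _ => fr k l) x⟫_ℝ +
              ⟪f x, realTrigPoly {k} (fun _ => fr k l) x⟫_ℝ) by
      exact h'.mono fun ω hω _ => hω
    rw [ae_all_iff]; intro l
    rw [ae_all_iff]; intro q
    rw [ae_all_iff]; intro q'
    by_cases hq : 0 ≤ q
    swap; · exact ae_of_all _ fun ω h => absurd h hq
    by_cases hqq : q ≤ q'
    swap; · exact ae_of_all _ fun ω _ h => absurd h hqq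
    obtain ⟨B, c, hc, hcB, hcw, hcu⟩ := stub_augLimitDriftTools (ν := ν) (hf.memLp 2) (hsm k l) R
    have h := stub_augLimitIdentTools (ν := ν) (f := f) (hsm k l) hR (Qt.map Prod.fst) P hleQ
      (hdrift _ (hsm k l) (isDivFree_realTrigPoly_singleton (hfrT k l)) (hasZeroMean_realTrigPoly_singleton_of_ne_zero hk _))
      hc hcB hcw hcu hq hqq
    filter_upwards [h] with ω hω _ _ using hω
  -- assembly along a typical path
  filter_upwards [hE, hZ, hI] with ω hEω hZω hIω
  obtain ⟨v, hvm, hv⟩ := exists_pathField ω.2 0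
  have hcoef : ∀ t, 0 ≤ t → MemLp (v t) 2 volume ∧
      ∀ k, mFourierCoeff (EuclideanSpace.complexify ∘ v t) k = pathExt ω.1 t k := fun t ht =>
    ⟨(hv t ht).1, fun k => by rw [(hv t ht).2 k, zero_add]⟩
  refine ⟨v, hvm, hcoef, fun M a ha s t hs hst => ?_, (hEω v hcoef).1, (hEω v hcoef).2⟩
  have happrox : ∀ k : Fin 3 → ℤ, k ≠ 0 → ∀ l : Fin 3 × Bool,
      ∃ (B : ℝ) (c : ℕ → ((Fin 3 → ℤ) → EuclideanSpace ℂ (Fin 3)) → ℝ),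
        (∀ M, Continuous (c M)) ∧ (∀ M z, |c M z| ≤ B) ∧
        (∀ w : UnitAddTorus (Fin 3) → EuclideanSpace ℝ (Fin 3), MemLp w 2 volume →
          ∫ x, ‖w x‖ ^ 2 ≤ R ^ 2 →
          Tendsto (fun M => c M fun k' => mFourierCoeff (EuclideanSpace.complexify ∘ w) k') atTop
            (𝓝 (∫ x, (⟪w x, convect w (realTrigPoly {k} fun _ => fr k l) x⟫_ℝ +
              ν * ⟪w x, laplacian (realTrigPoly {k} fun _ => fr k l) x⟫_ℝ +
              ⟪f x, realTrigPoly {k} (fun _ => fr k l) x⟫_ℝ)))) := fun k _ l => by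
    obtain ⟨B, c, hc, hcB, hcw, -⟩ := stub_augLimitDriftTools (ν := ν) (hf.memLp 2) (hsm k l) R
    exact ⟨B, c, hc, hcB, hcw⟩
  exact stub_augLimitModesTools (hf.memLp 2) hf0 ω.2 hcoef hZω fr hfr happrox
    (fun k hk l q q' hq hqq => hIω k hk l q q' hq hqq v hcoef) M a ha hs hst

end Summit.AnomalousDissipation.AnomalousDissipation.Theorems.EnsembleRealization
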